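import Mathlib
import HarnessLib
import Summits.HubbardSuperconductivity.HubbardSuperconductivity.Theorems.KLProgrammeKLRegimeEnginePairTransferDLineEdgeForward

/-!
# Route `KLProgramme` — ENGINE item stmt-HubbardSuperconductivity-20437 `KLRegimeEngineV17F2`, AMENDMENT 25 «FLAT-CUBIC» door (ii), condition (i) of (R269)(C):
# `klC3` IN CLOSED FORM — the pinned pair's `W`-part rows read as ONE flat cubic (cell gate-hubbard-kl, seat hubbard-kl-k3c2-p2 g21; CANDIDATE definitions, no token role yet)

THE OBJECT.  At the pinned pair the class-#5 STEP meets the signed `D`-rows `dLine_pinned_direct/crossed_signed_le_split_const` (…DLineEdgeSplit(Crossed), g20):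
the kernel `V_j⊗V_j = c + F_W` is split into its LOCAL part `c = λ²` (zero Lipschitz/flatness data — pure zero sound, booked in the ROOM's decaying slots by
`pinned_row_le_slots`) and the DRESSED part `F_W = λ⊗W + W⊗λ + W⊗W` with data `(A_W, L_W, ε_W)` = (sup, loop-momentum Lipschitz constant, frequency flatness
over `|ω| ≤ 4Λₙ₊₁`) of `Σ_σ F_W`.  Door (ii) ((R260)(2)) books the `F_W`-rows as ONE FLAT CUBIC `∝ (Klam|U|)³` per pair.  THIS FILE fixes the constant: in the
CUBIC CURRENCY of the three class-#1 sizes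
  **`A_W ≤ a_W·X`, `L_W ≤ l_W·X/Λₙ₊₁`, `ε_W ≤ e_W·X`, `X := (Klam|U|)³`**
(dictionary to the vertex-level names of PINNED-PAIR-FORWARD §3: `|λ| ≤ λ̄·Klam|U|`, `sup|W| ≤ w̄(KlamU)²`, `Lip_k W ≤ ℓ_W(KlamU)²/Λₙ₊₁`, `Lip_ω W ≤ e′_W(KlamU)²/Λₙ₊₁` ⇒
`a_W = 2(2λ̄w̄ + w̄²Klam|U|)`, `l_W = 2(2λ̄ℓ_W + 2w̄ℓ_W·Klam|U|)`, `e_W = 8·(2λ̄e′_W + …)` — products of sups and Lipschitz constants, σ-sum = factor 2),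
the whole `W`-part of ONE pinned row — `2(Λₙ−Λₙ₊₁)·Row_{n+2}(A_W, L_W)` in the ROOM's normalisation (`pinned_row_le_slots` / `_shift`) PLUS its flatness remainder
`ε_W·512·15367` (`pinned_flat_le`) — is `≤ klC3W d A G a_W l_W e_W · X` with the CLOSED FORM
`klC3W d A G a l e := (3/π)·klPinCZ·(2π√2·l/(d−4A)² + a/32·(40π√2/(d−4A)² + 2/(d−4A)² + (41/10)π√2/(d−4A)³))`
`  + (12/π)·(klPinCT + 2·klPinCR)·(2a·π√2/(d−4A)) + (3/π)·klPinCR·(2a·π√2/(d−4A))·G + 3072/π²·(512·l + 32·a·G·klPinCL) + 512·15367·e`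
(`klPinCZ = 524288/π·(1024 + 2(448/3)e² + 8 + 64)`, `klPinCT = 393216/π·(same)`, `klPinCR = 2048/π·(65·128 + 17408/3)`, `klPinCL = 9(2(448/3)e² + 8) + 32 + 65·128 + 17408/3`;
`d − 4A` = band `Dtmin` minus the frame's C² size, `G = 4 + 8/3·Gfr₁U² ≤ 5`), using only `Λₙ₊₁ ≤ klE0/4 = 1/32`, `π/(4β) ≤ Λₙ₊₁` (`n ≤ n_β`), `β² ≤ L`, `(4^{n_β−n})⁻¹ ≤ 1`, `min ≤ 1`.
* §1 the numerals and `klC3W` (+ `_nonneg`, monotone in `G`);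
* §2 `pinned_flat_arith` (atoms) ⇒ **`pinned_W_row_le_klC3W`** (direct row) / **`pinned_W_row_shift_le_klC3W`** (crossed row): the RHS of `pinned_row_le_slots(_shift)` at
  `(A₀, L_A) := (a·X, l·X/Λₙ₊₁)` plus `e·X·(512·15367)` is `≤ klC3W d A G a l e · X`;
* §3 the bar-level constant: per pinned pair entry the (B4) interior meets ONE direct and ONE crossed `W`-row ⇒ flat allowance `2·klC3W·X`; in `transferBarRelIdx3`'s slot
  `klIdxPrefactor r (n+1)·klC3·X·klIdxOverlap (n+1)(n+1)` (`klIdxOverlap = 15367`, `r ≤ klIdxPrefactor r (n+1)`, producer floor `1 ≤ r`) this is met by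
  **`klC3 := 2·klC3W(…)/15367`** (`klC3_of_rows`) — k3c1's (B4) twin confirms the multiplicity.
Arithmetic over landed lemmas + candidate definitions (text-neutral; the pen names the token); nothing about the model's sizes `a_W, l_W, e_W` is asserted; nothing asserts
(X).3, (c), K3 or superconductivity.  0 kit · 0 lit.
-/

noncomputable section

namespace Summit.HubbardSuperconductivity.HubbardSuperconductivity.Theorems.EngineV8

set_option linter.dupNamespace false -- summit = problem name (single-conjunct summit), D-0017

open Real Finset Literature.MathematicalPhysics.QuantumLattice Literature.Probability.LatticeModels
open Summit.HubbardSuperconductivity.HubbardSuperconductivity.Theorems.KLRegimeSplit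
open Summit.HubbardSuperconductivity.HubbardSuperconductivity.Theorems.KLProgrammeLegKernels
open Summit.HubbardSuperconductivity.HubbardSuperconductivity.Theorems.DispersionFlow

/-! ## §1 The numerals and the closed form -/

/-- `klPinCZ := 524288/π·(64·16 + (2·(448/3)·e² + 8) + 64)` — the zero-sound numeral `ZS⋆`'s prefactor (`pinned_rowBound_reading`). -/
def klPinCZ : ℝ := 524288 / Real.pi * (64 * 16 + (2 * (448 / 3 * Real.exp 2) + 8) + 64)

/-- `klPinCT := 393216/π·(64·16 + (2·(448/3)·e² + 8) + 64)` — the thermal numeral `TH⋆`'s prefactor. -/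
def klPinCT : ℝ := 393216 / Real.pi * (64 * 16 + (2 * (448 / 3 * Real.exp 2) + 8) + 64)

/-- `klPinCR := 256/π·8·(65·(8·16) + 17408/3·1)` — the transfer numeral `TR⋆`'s prefactor (with the shell-count bracket). -/
def klPinCR : ℝ := 256 / Real.pi * 8 * (65 * (8 * (16 : ℝ)) + 17408 / 3 * 1)

/-- `klPinCL := (9·(2·(448/3)·e² + 8) + 4·8) + (65·(8·16) + 17408/3·1)` — the lattice numeral `LAT⋆`'s bracket. -/
def klPinCL : ℝ := (9 * (2 * (448 / 3 * Real.exp 2) + 8) + 4 * 8) + (65 * (8 * (16 : ℝ)) + 17408 / 3 * 1)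

/-- `0 ≤ klPinCZ`. -/
theorem klPinCZ_nonneg : 0 ≤ klPinCZ := by unfold klPinCZ; positivity
/-- `0 ≤ klPinCT`. -/
theorem klPinCT_nonneg : 0 ≤ klPinCT := by unfold klPinCT; positivity
/-- `0 ≤ klPinCR`. -/
theorem klPinCR_nonneg : 0 ≤ klPinCR := by unfold klPinCR; positivity
/-- `0 ≤ klPinCL`. -/
theorem klPinCL_nonneg : 0 ≤ klPinCL := by unfold klPinCL; positivity

/-- **`klC3W d A G a l e`** — THE FLAT-CUBIC COEFFICIENT OF ONE PINNED `W`-ROW (crossed form, which dominates the direct one): see the module docstring. -/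
def klC3W (d A G a l e : ℝ) : ℝ :=
  3 / π * klPinCZ * (2 * (Real.pi * Real.sqrt 2) * l / (d - 4 * A) ^ 2 +
      a / 32 * (40 * (Real.pi * Real.sqrt 2) / (d - 4 * A) ^ 2 + 2 / (d - 4 * A) ^ 2 + 41 / 10 * (Real.pi * Real.sqrt 2) / (d - 4 * A) ^ 3)) +
    12 / π * (klPinCT + 2 * klPinCR) * (2 * a * (Real.pi * Real.sqrt 2 / (d - 4 * A))) +
    3 / π * klPinCR * (2 * a * (Real.pi * Real.sqrt 2 / (d - 4 * A))) * G +
    3072 / π ^ 2 * (512 * l + 32 * a * G * klPinCL) + 512 * 15367 * e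

/-- `klC3W` unfolded. -/
theorem klC3W_eq (d A G a l e : ℝ) : klC3W d A G a l e =
    3 / π * klPinCZ * (2 * (Real.pi * Real.sqrt 2) * l / (d - 4 * A) ^ 2 +
        a / 32 * (40 * (Real.pi * Real.sqrt 2) / (d - 4 * A) ^ 2 + 2 / (d - 4 * A) ^ 2 + 41 / 10 * (Real.pi * Real.sqrt 2) / (d - 4 * A) ^ 3)) +
      12 / π * (klPinCT + 2 * klPinCR) * (2 * a * (Real.pi * Real.sqrt 2 / (d - 4 * A))) +
      3 / π * klPinCR * (2 * a * (Real.pi * Real.sqrt 2 / (d - 4 * A))) * G +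
      3072 / π ^ 2 * (512 * l + 32 * a * G * klPinCL) + 512 * 15367 * e := rfl

/-- `0 ≤ klC3W` for `0 < d − 4A` and non-negative `G, a, l, e`. -/
theorem klC3W_nonneg {d A G a l e : ℝ} (hdA : 0 < d - 4 * A) (hG : 0 ≤ G) (ha : 0 ≤ a) (hl : 0 ≤ l) (he : 0 ≤ e) : 0 ≤ klC3W d A G a l e := by
  unfold klC3W
  have := klPinCZ_nonneg; have := klPinCT_nonneg; have := klPinCR_nonneg; have := klPinCL_nonneg
  positivity

/-! ## §2 The pinned `W`-rows are ONE flat cubic -/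

/-- **Arithmetic core** (all sizes atoms): with `0 < D`, `0 ≤ A`, `4A ≤ 1/20`, `0 ≤ G`, `a, l, e, X ≥ 0`, `0 ≤ q ≤ 1`, `0 ≤ mn ≤ 1`, `0 < Λ ≤ 1/32`, `π/(4β) ≤ Λ`, `0 < β`,
`β² ≤ L`, and non-negative numerals `CZ CT CR CL`:
the crossed-form row at `(A₀, La) := (aX, lX/Λ)` plus `eX·(512·15367)` is at most the closed form times `X`. -/
theorem pinned_flat_arith {CZ CT CR CL D A G a l e X q mn Λ β L : ℝ} (hCZ : 0 ≤ CZ) (hCT : 0 ≤ CT) (hCR : 0 ≤ CR) (hCL : 0 ≤ CL)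
    (hD : 0 < D) (hA : 0 ≤ A) (hA20 : 4 * A ≤ 1 / 20) (hG : 0 ≤ G) (ha : 0 ≤ a) (hl : 0 ≤ l) (hX : 0 ≤ X)
    (hq1 : q ≤ 1) (hmn1 : mn ≤ 1) (hΛ : 0 < Λ) (hΛ32 : Λ ≤ 1 / 32) (hβ : 0 < β) (hβΛ : Real.pi / (4 * β) ≤ Λ)
    (hL : 0 < L) (hβL : β ^ 2 ≤ L) :
    3 / π * (CZ * (Real.pi * Real.sqrt 2 / D * (2 * (l * X / Λ) + 2 * (a * X) * (2 / (1 / 10))) / D +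
          2 * (a * X) * (1 / D ^ 2 + Real.pi * Real.sqrt 2 * (2 + 4 * A) / D ^ 3))) * Λ +
        12 / π * (CT * (2 * (a * X) * (Real.pi * Real.sqrt 2 / D)) + 2 * (CR * (2 * (a * X) * (Real.pi * Real.sqrt 2 / D)))) * q +
        3 / π * (CR * (2 * (a * X) * (Real.pi * Real.sqrt 2 / D))) * (G * mn) +
        2 * (96 * (512 * (l * X / Λ) / Λ + 32 * (a * X) * G * CL / Λ ^ 2) / L) +
        e * X * (512 * 15367) ≤
      (3 / π * CZ * (2 * (Real.pi * Real.sqrt 2) * l / D ^ 2 + a / 32 * (40 * (Real.pi * Real.sqrt 2) / D ^ 2 + 2 / D ^ 2 + 41 / 10 * (Real.pi * Real.sqrt 2) / D ^ 3)) +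
        12 / π * (CT + 2 * CR) * (2 * a * (Real.pi * Real.sqrt 2 / D)) +
        3 / π * CR * (2 * a * (Real.pi * Real.sqrt 2 / D)) * G +
        3072 / π ^ 2 * (512 * l + 32 * a * G * CL) + 512 * 15367 * e) * X := by
  have hπ := Real.pi_pos
  have hps : 0 ≤ Real.pi * Real.sqrt 2 := by positivity
  have hΛne : Λ ≠ 0 := hΛ.ne'
  -- (T1) the zero-sound term
  have hT1 : 3 / π * (CZ * (Real.pi * Real.sqrt 2 / D * (2 * (l * X / Λ) + 2 * (a * X) * (2 / (1 / 10))) / D +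
          2 * (a * X) * (1 / D ^ 2 + Real.pi * Real.sqrt 2 * (2 + 4 * A) / D ^ 3))) * Λ ≤
      3 / π * CZ * (2 * (Real.pi * Real.sqrt 2) * l / D ^ 2 + a / 32 * (40 * (Real.pi * Real.sqrt 2) / D ^ 2 + 2 / D ^ 2 + 41 / 10 * (Real.pi * Real.sqrt 2) / D ^ 3)) * X := by
    have e1 : 3 / π * (CZ * (Real.pi * Real.sqrt 2 / D * (2 * (l * X / Λ) + 2 * (a * X) * (2 / (1 / 10))) / D +
          2 * (a * X) * (1 / D ^ 2 + Real.pi * Real.sqrt 2 * (2 + 4 * A) / D ^ 3))) * Λ =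
        3 / π * CZ * (2 * (Real.pi * Real.sqrt 2) * l / D ^ 2 * X +
          Λ * (a * X) * (40 * (Real.pi * Real.sqrt 2) / D ^ 2 + 2 / D ^ 2 + 2 * (2 + 4 * A) * (Real.pi * Real.sqrt 2) / D ^ 3)) := by
      field_simp
      ring
    rw [e1]
    have hin : Λ * (a * X) * (40 * (Real.pi * Real.sqrt 2) / D ^ 2 + 2 / D ^ 2 + 2 * (2 + 4 * A) * (Real.pi * Real.sqrt 2) / D ^ 3) ≤
        1 / 32 * (a * X) * (40 * (Real.pi * Real.sqrt 2) / D ^ 2 + 2 / D ^ 2 + 41 / 10 * (Real.pi * Real.sqrt 2) / D ^ 3) := by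
      have hb1 : 2 * (2 + 4 * A) * (Real.pi * Real.sqrt 2) / D ^ 3 ≤ 41 / 10 * (Real.pi * Real.sqrt 2) / D ^ 3 := by
        have hD3 : 0 < D ^ 3 := by positivity
        rw [div_le_div_iff_of_pos_right hD3]
        nlinarith
      have hB0 : 0 ≤ 40 * (Real.pi * Real.sqrt 2) / D ^ 2 + 2 / D ^ 2 + 2 * (2 + 4 * A) * (Real.pi * Real.sqrt 2) / D ^ 3 := by positivity
      have haX : 0 ≤ a * X := mul_nonneg ha hX
      calc Λ * (a * X) * (40 * (Real.pi * Real.sqrt 2) / D ^ 2 + 2 / D ^ 2 + 2 * (2 + 4 * A) * (Real.pi * Real.sqrt 2) / D ^ 3)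
          ≤ 1 / 32 * (a * X) * (40 * (Real.pi * Real.sqrt 2) / D ^ 2 + 2 / D ^ 2 + 2 * (2 + 4 * A) * (Real.pi * Real.sqrt 2) / D ^ 3) :=
            mul_le_mul_of_nonneg_right (mul_le_mul_of_nonneg_right hΛ32 haX) hB0
        _ ≤ 1 / 32 * (a * X) * (40 * (Real.pi * Real.sqrt 2) / D ^ 2 + 2 / D ^ 2 + 41 / 10 * (Real.pi * Real.sqrt 2) / D ^ 3) :=
            mul_le_mul_of_nonneg_left (by linarith) (by positivity)
    have hCZ3 : 0 ≤ 3 / π * CZ := by positivity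
    have := mul_le_mul_of_nonneg_left hin hCZ3
    have e2 : 3 / π * CZ * (2 * (Real.pi * Real.sqrt 2) * l / D ^ 2 + a / 32 * (40 * (Real.pi * Real.sqrt 2) / D ^ 2 + 2 / D ^ 2 + 41 / 10 * (Real.pi * Real.sqrt 2) / D ^ 3)) * X =
        3 / π * CZ * (2 * (Real.pi * Real.sqrt 2) * l / D ^ 2 * X) +
          3 / π * CZ * (1 / 32 * (a * X) * (40 * (Real.pi * Real.sqrt 2) / D ^ 2 + 2 / D ^ 2 + 41 / 10 * (Real.pi * Real.sqrt 2) / D ^ 3)) := by ring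
    rw [e2, mul_add]
    linarith
  -- (T2) the thermal term (`q ≤ 1`)
  have hT2 : 12 / π * (CT * (2 * (a * X) * (Real.pi * Real.sqrt 2 / D)) + 2 * (CR * (2 * (a * X) * (Real.pi * Real.sqrt 2 / D)))) * q ≤
      12 / π * (CT + 2 * CR) * (2 * a * (Real.pi * Real.sqrt 2 / D)) * X := by
    have h0 : 0 ≤ 12 / π * (CT * (2 * (a * X) * (Real.pi * Real.sqrt 2 / D)) + 2 * (CR * (2 * (a * X) * (Real.pi * Real.sqrt 2 / D)))) := by positivity
    calc 12 / π * (CT * (2 * (a * X) * (Real.pi * Real.sqrt 2 / D)) + 2 * (CR * (2 * (a * X) * (Real.pi * Real.sqrt 2 / D)))) * q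
        ≤ 12 / π * (CT * (2 * (a * X) * (Real.pi * Real.sqrt 2 / D)) + 2 * (CR * (2 * (a * X) * (Real.pi * Real.sqrt 2 / D)))) * 1 :=
          mul_le_mul_of_nonneg_left hq1 h0
      _ = 12 / π * (CT + 2 * CR) * (2 * a * (Real.pi * Real.sqrt 2 / D)) * X := by ring
  -- (T3) the transfer term (`mn ≤ 1`)
  have hT3 : 3 / π * (CR * (2 * (a * X) * (Real.pi * Real.sqrt 2 / D))) * (G * mn) ≤ 3 / π * CR * (2 * a * (Real.pi * Real.sqrt 2 / D)) * G * X := by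
    have h0 : 0 ≤ 3 / π * (CR * (2 * (a * X) * (Real.pi * Real.sqrt 2 / D))) * G := by positivity
    calc 3 / π * (CR * (2 * (a * X) * (Real.pi * Real.sqrt 2 / D))) * (G * mn) = 3 / π * (CR * (2 * (a * X) * (Real.pi * Real.sqrt 2 / D))) * G * mn := by ring
      _ ≤ 3 / π * (CR * (2 * (a * X) * (Real.pi * Real.sqrt 2 / D))) * G * 1 := mul_le_mul_of_nonneg_left hmn1 h0
      _ = 3 / π * CR * (2 * a * (Real.pi * Real.sqrt 2 / D)) * G * X := by ring
  -- (T4) the lattice term (`1/Λ² ≤ 16β²/π²`, `β² ≤ L`)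
  have hT4 : 2 * (96 * (512 * (l * X / Λ) / Λ + 32 * (a * X) * G * CL / Λ ^ 2) / L) ≤ 3072 / π ^ 2 * (512 * l + 32 * a * G * CL) * X := by
    have e1 : 2 * (96 * (512 * (l * X / Λ) / Λ + 32 * (a * X) * G * CL / Λ ^ 2) / L) = 192 * (512 * l + 32 * a * G * CL) * X * ((Λ ^ 2)⁻¹ * L⁻¹) := by
      field_simp
      ring
    rw [e1]
    have hinv : (Λ ^ 2)⁻¹ * L⁻¹ ≤ 16 / π ^ 2 := by
      -- `π²/(16β²) ≤ Λ²` and `β² ≤ L` ⇒ `1/(Λ²L) ≤ 16β²/(π²·L) ≤ 16/π²`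
      have hΛ2 : (Real.pi / (4 * β)) ^ 2 ≤ Λ ^ 2 := pow_le_pow_left₀ (by positivity) hβΛ 2
      have hπβ : 0 < (Real.pi / (4 * β)) ^ 2 := by positivity
      have h1 : (Λ ^ 2)⁻¹ ≤ ((Real.pi / (4 * β)) ^ 2)⁻¹ := by
        rw [inv_le_inv₀ (by positivity) hπβ]; exact hΛ2
      have h2 : ((Real.pi / (4 * β)) ^ 2)⁻¹ = 16 * β ^ 2 / π ^ 2 := by field_simp; ring
      have h3 : L⁻¹ ≤ (β ^ 2)⁻¹ := by rw [inv_le_inv₀ hL (by positivity)]; exact hβL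
      calc (Λ ^ 2)⁻¹ * L⁻¹ ≤ (16 * β ^ 2 / π ^ 2) * (β ^ 2)⁻¹ := mul_le_mul (h1.trans (le_of_eq h2)) h3 (by positivity) (by positivity)
        _ = 16 / π ^ 2 := by field_simp
    have h0 : 0 ≤ 192 * (512 * l + 32 * a * G * CL) * X := by positivity
    calc 192 * (512 * l + 32 * a * G * CL) * X * ((Λ ^ 2)⁻¹ * L⁻¹) ≤ 192 * (512 * l + 32 * a * G * CL) * X * (16 / π ^ 2) :=
          mul_le_mul_of_nonneg_left hinv h0
      _ = 3072 / π ^ 2 * (512 * l + 32 * a * G * CL) * X := by ring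
  have e5 : e * X * (512 * 15367) = 512 * 15367 * e * X := by ring
  rw [e5]
  have etot : (3 / π * CZ * (2 * (Real.pi * Real.sqrt 2) * l / D ^ 2 + a / 32 * (40 * (Real.pi * Real.sqrt 2) / D ^ 2 + 2 / D ^ 2 + 41 / 10 * (Real.pi * Real.sqrt 2) / D ^ 3)) +
        12 / π * (CT + 2 * CR) * (2 * a * (Real.pi * Real.sqrt 2 / D)) +
        3 / π * CR * (2 * a * (Real.pi * Real.sqrt 2 / D)) * G +
        3072 / π ^ 2 * (512 * l + 32 * a * G * CL) + 512 * 15367 * e) * X =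
      3 / π * CZ * (2 * (Real.pi * Real.sqrt 2) * l / D ^ 2 + a / 32 * (40 * (Real.pi * Real.sqrt 2) / D ^ 2 + 2 / D ^ 2 + 41 / 10 * (Real.pi * Real.sqrt 2) / D ^ 3)) * X +
        12 / π * (CT + 2 * CR) * (2 * a * (Real.pi * Real.sqrt 2 / D)) * X +
        3 / π * CR * (2 * a * (Real.pi * Real.sqrt 2 / D)) * G * X +
        3072 / π ^ 2 * (512 * l + 32 * a * G * CL) * X + 512 * 15367 * e * X := by ring
  rw [etot]
  linarith

variable {β : ℝ} {L : ℕ} [NeZero L]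

/-- The three scale facts at the pinned pair: `Λₙ₊₁ = klE0·(4ⁿ⁺¹)⁻¹` (`rfl`), `Λₙ₊₁ ≤ 1/32`, and `π/(4β) ≤ Λₙ₊₁` for `n ≤ n_β`, `klBetaMin ≤ β`. -/
theorem klScale_succ_pinned_facts (hβ : klBetaMin ≤ β) {n : ℕ} (hn : n ≤ nScales β) :
    klScale klE0 (n + 1) = klE0 * ((4 : ℝ) ^ (n + 1))⁻¹ ∧ klScale klE0 (n + 1) ≤ 1 / 32 ∧ Real.pi / (4 * β) ≤ klScale klE0 (n + 1) := by
  have hβ0 : 0 < β := lt_of_lt_of_le (by norm_num [klBetaMin]) hβ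
  refine ⟨rfl, ?_, ?_⟩
  · show klE0 * ((4 : ℝ) ^ (n + 1))⁻¹ ≤ 1 / 32
    unfold klE0
    have h4 : (4 : ℝ) ≤ 4 ^ (n + 1) := by
      calc (4 : ℝ) = 4 ^ 1 := (pow_one _).symm
        _ ≤ 4 ^ (n + 1) := pow_le_pow_right₀ (by norm_num) (by omega)
    have : ((4 : ℝ) ^ (n + 1))⁻¹ ≤ 4⁻¹ := by rw [inv_le_inv₀ (by positivity) (by norm_num)]; exact h4
    nlinarith
  · have hπ := klth_pi_div_le_klScale_nScales hβ
    rw [klth_klScale_succ]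
    have hmono : klScale klE0 (nScales β) ≤ klScale klE0 n := by
      show klE0 * ((4 : ℝ) ^ (nScales β))⁻¹ ≤ klE0 * ((4 : ℝ) ^ n)⁻¹
      have : ((4 : ℝ) ^ (nScales β))⁻¹ ≤ ((4 : ℝ) ^ n)⁻¹ := by
        rw [inv_le_inv₀ (by positivity) (by positivity)]; exact pow_le_pow_right₀ (by norm_num) hn
      exact mul_le_mul_of_nonneg_left this (by unfold klE0; norm_num)
    have hle := hπ.trans hmono
    have e : Real.pi / (4 * β) = Real.pi / β / 4 := by field_simp
    rw [e]
    linarith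

/-- **THE PINNED DIRECT `W`-ROW IS ONE FLAT CUBIC** (module docstring): for `0 < d − 4A`, `0 ≤ A`, `4A ≤ 1/20`, `0 ≤ G`, `a, l, e, X ≥ 0`, `klBetaMin ≤ β`, `n ≤ n_β`,
`0 < r ≤ Λₙ₊₁`, `β² ≤ L`: the RHS of `pinned_row_le_slots` at `(A₀, L_A) := (a·X, l·X/Λₙ₊₁)` plus the flatness remainder `e·X·(512·15367)` is `≤ klC3W d A G a l e · X`. -/
theorem pinned_W_row_le_klC3W {d A G a l e X : ℝ} (hdA : 0 < d - 4 * A) (hA : 0 ≤ A) (hA20 : 4 * A ≤ 1 / 20) (hG : 0 ≤ G) (ha : 0 ≤ a) (hl : 0 ≤ l)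
    (hX : 0 ≤ X) (hβ : klBetaMin ≤ β) {n : ℕ} (hn : n ≤ nScales β) {r : ℝ} (hrΛ : r ≤ klScale klE0 (n + 1)) (hβL : β ^ 2 ≤ (L : ℝ)) :
    3 / π * (klPinCZ *
            (Real.pi * Real.sqrt 2 / (d - 4 * A) * (2 * (l * X / klScale klE0 (n + 1)) + 2 * (a * X) * (2 / (1 / 10))) / (d - 4 * A) +
              2 * (a * X) * (1 / (d - 4 * A) ^ 2 + Real.pi * Real.sqrt 2 * (2 + 4 * A) / (d - 4 * A) ^ 3))) *
          klE0 * ((4 : ℝ) ^ (n + 1))⁻¹ +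
        12 / π * (klPinCT * (2 * (a * X) * (Real.pi * Real.sqrt 2 / (d - 4 * A)))) * ((4 : ℝ) ^ (nScales β - n))⁻¹ +
        3 / π * (klPinCR * (2 * (a * X) * (Real.pi * Real.sqrt 2 / (d - 4 * A)))) *
          (G * min (r / klScale klE0 (n + 1)) (klScale klE0 (n + 1) / r)) +
        2 * (96 * (512 * (l * X / klScale klE0 (n + 1)) / klScale klE0 (n + 1) + 32 * (a * X) * G * klPinCL / klScale klE0 (n + 1) ^ 2) / L) +
        e * X * (512 * 15367) ≤
      klC3W d A G a l e * X := by
  obtain ⟨hΛeq, hΛ32, hβΛ⟩ := klScale_succ_pinned_facts hβ hn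
  have hβ0 : 0 < β := lt_of_lt_of_le (by norm_num [klBetaMin]) hβ
  have hΛ := klth_klScale_pos (n + 1)
  have hq1 : ((4 : ℝ) ^ (nScales β - n))⁻¹ ≤ 1 := inv_le_one_of_one_le₀ (one_le_pow₀ (by norm_num))
  have hmn1 : min (r / klScale klE0 (n + 1)) (klScale klE0 (n + 1) / r) ≤ 1 := (min_le_left _ _).trans (by rw [div_le_one hΛ]; exact hrΛ)
  have hL' : (0 : ℝ) < L := by exact_mod_cast Nat.pos_of_ne_zero (NeZero.ne L)
  have h := pinned_flat_arith (CZ := klPinCZ) (CT := klPinCT) (CR := klPinCR) (CL := klPinCL) (D := d - 4 * A) (e := e)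
    klPinCZ_nonneg klPinCT_nonneg klPinCR_nonneg klPinCL_nonneg hdA hA hA20 hG ha hl hX hq1 hmn1 hΛ hΛ32 hβ0 hβΛ hL' hβL
  rw [klC3W_eq]
  -- the thermal term of the direct row is dominated by the crossed form's `(CT + 2CR)`
  have hTR0 : 0 ≤ 12 / π * (2 * (klPinCR * (2 * (a * X) * (Real.pi * Real.sqrt 2 / (d - 4 * A))))) * ((4 : ℝ) ^ (nScales β - n))⁻¹ := by
    have := klPinCR_nonneg; have := Real.pi_pos; positivity
  have e1 : 3 / π * (klPinCZ *
            (Real.pi * Real.sqrt 2 / (d - 4 * A) * (2 * (l * X / klScale klE0 (n + 1)) + 2 * (a * X) * (2 / (1 / 10))) / (d - 4 * A) +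
              2 * (a * X) * (1 / (d - 4 * A) ^ 2 + Real.pi * Real.sqrt 2 * (2 + 4 * A) / (d - 4 * A) ^ 3))) *
          klE0 * ((4 : ℝ) ^ (n + 1))⁻¹ =
      3 / π * (klPinCZ *
            (Real.pi * Real.sqrt 2 / (d - 4 * A) * (2 * (l * X / klScale klE0 (n + 1)) + 2 * (a * X) * (2 / (1 / 10))) / (d - 4 * A) +
              2 * (a * X) * (1 / (d - 4 * A) ^ 2 + Real.pi * Real.sqrt 2 * (2 + 4 * A) / (d - 4 * A) ^ 3))) * klScale klE0 (n + 1) := by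
    rw [hΛeq]; ring
  rw [e1]
  have e2 : 12 / π * (klPinCT * (2 * (a * X) * (Real.pi * Real.sqrt 2 / (d - 4 * A))) + 2 * (klPinCR * (2 * (a * X) * (Real.pi * Real.sqrt 2 / (d - 4 * A))))) *
        ((4 : ℝ) ^ (nScales β - n))⁻¹ =
      12 / π * (klPinCT * (2 * (a * X) * (Real.pi * Real.sqrt 2 / (d - 4 * A)))) * ((4 : ℝ) ^ (nScales β - n))⁻¹ +
        12 / π * (2 * (klPinCR * (2 * (a * X) * (Real.pi * Real.sqrt 2 / (d - 4 * A))))) * ((4 : ℝ) ^ (nScales β - n))⁻¹ := by ring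
  rw [e2] at h
  linarith

/-- **THE PINNED CROSSED `W`-ROW IS ONE FLAT CUBIC**: the RHS of `pinned_row_le_slots_shift` at `(A₀, L_A) := (a·X, l·X/Λₙ₊₁)` plus `e·X·(512·15367)` is `≤ klC3W d A G a l e · X`. -/
theorem pinned_W_row_shift_le_klC3W {d A G a l e X : ℝ} (hdA : 0 < d - 4 * A) (hA : 0 ≤ A) (hA20 : 4 * A ≤ 1 / 20) (hG : 0 ≤ G) (ha : 0 ≤ a) (hl : 0 ≤ l)
    (hX : 0 ≤ X) (hβ : klBetaMin ≤ β) {n : ℕ} (hn : n ≤ nScales β) {r : ℝ} (hrΛ : r ≤ klScale klE0 (n + 1)) (hβL : β ^ 2 ≤ (L : ℝ)) :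
    3 / π * (klPinCZ *
            (Real.pi * Real.sqrt 2 / (d - 4 * A) * (2 * (l * X / klScale klE0 (n + 1)) + 2 * (a * X) * (2 / (1 / 10))) / (d - 4 * A) +
              2 * (a * X) * (1 / (d - 4 * A) ^ 2 + Real.pi * Real.sqrt 2 * (2 + 4 * A) / (d - 4 * A) ^ 3))) *
          klE0 * ((4 : ℝ) ^ (n + 1))⁻¹ +
        12 / π * (klPinCT * (2 * (a * X) * (Real.pi * Real.sqrt 2 / (d - 4 * A))) +
            2 * (klPinCR * (2 * (a * X) * (Real.pi * Real.sqrt 2 / (d - 4 * A))))) * ((4 : ℝ) ^ (nScales β - n))⁻¹ +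
        3 / π * (klPinCR * (2 * (a * X) * (Real.pi * Real.sqrt 2 / (d - 4 * A)))) *
          (G * min (r / klScale klE0 (n + 1)) (klScale klE0 (n + 1) / r)) +
        2 * (96 * (512 * (l * X / klScale klE0 (n + 1)) / klScale klE0 (n + 1) + 32 * (a * X) * G * klPinCL / klScale klE0 (n + 1) ^ 2) / L) +
        e * X * (512 * 15367) ≤
      klC3W d A G a l e * X := by
  obtain ⟨hΛeq, hΛ32, hβΛ⟩ := klScale_succ_pinned_facts hβ hn
  have hβ0 : 0 < β := lt_of_lt_of_le (by norm_num [klBetaMin]) hβ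
  have hΛ := klth_klScale_pos (n + 1)
  have hq1 : ((4 : ℝ) ^ (nScales β - n))⁻¹ ≤ 1 := inv_le_one_of_one_le₀ (one_le_pow₀ (by norm_num))
  have hmn1 : min (r / klScale klE0 (n + 1)) (klScale klE0 (n + 1) / r) ≤ 1 := (min_le_left _ _).trans (by rw [div_le_one hΛ]; exact hrΛ)
  have hL' : (0 : ℝ) < L := by exact_mod_cast Nat.pos_of_ne_zero (NeZero.ne L)
  have h := pinned_flat_arith (CZ := klPinCZ) (CT := klPinCT) (CR := klPinCR) (CL := klPinCL) (D := d - 4 * A) (e := e)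
    klPinCZ_nonneg klPinCT_nonneg klPinCR_nonneg klPinCL_nonneg hdA hA hA20 hG ha hl hX hq1 hmn1 hΛ hΛ32 hβ0 hβΛ hL' hβL
  rw [klC3W_eq]
  have e1 : 3 / π * (klPinCZ *
            (Real.pi * Real.sqrt 2 / (d - 4 * A) * (2 * (l * X / klScale klE0 (n + 1)) + 2 * (a * X) * (2 / (1 / 10))) / (d - 4 * A) +
              2 * (a * X) * (1 / (d - 4 * A) ^ 2 + Real.pi * Real.sqrt 2 * (2 + 4 * A) / (d - 4 * A) ^ 3))) *
          klE0 * ((4 : ℝ) ^ (n + 1))⁻¹ =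
      3 / π * (klPinCZ *
            (Real.pi * Real.sqrt 2 / (d - 4 * A) * (2 * (l * X / klScale klE0 (n + 1)) + 2 * (a * X) * (2 / (1 / 10))) / (d - 4 * A) +
              2 * (a * X) * (1 / (d - 4 * A) ^ 2 + Real.pi * Real.sqrt 2 * (2 + 4 * A) / (d - 4 * A) ^ 3))) * klScale klE0 (n + 1) := by
    rw [hΛeq]; ring
  rw [e1]
  linarith

/-- **Consistency with the landed rows**: the `ZS⋆/TH⋆/TR⋆/LAT⋆` brackets of `pinned_row_le_slots(_shift)` ARE `klPinCZ/klPinCT/klPinCR/klPinCL` (`rfl`), so the two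
theorems above apply to their right-hand sides VERBATIM after `rw [klPinCZ_eq, …]`. -/
theorem klPinCZ_eq : klPinCZ = 524288 / Real.pi * (64 * 16 + (2 * (448 / 3 * Real.exp 2) + 8) + 64) := rfl
/-- see `klPinCZ_eq`. -/
theorem klPinCT_eq : klPinCT = 393216 / Real.pi * (64 * 16 + (2 * (448 / 3 * Real.exp 2) + 8) + 64) := rfl
/-- see `klPinCZ_eq`. -/
theorem klPinCR_eq : klPinCR = 256 / Real.pi * 8 * (65 * (8 * (16 : ℝ)) + 17408 / 3 * 1) := rfl
/-- see `klPinCZ_eq`. -/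
theorem klPinCL_eq : klPinCL = (9 * (2 * (448 / 3 * Real.exp 2) + 8) + 4 * 8) + (65 * (8 * (16 : ℝ)) + 17408 / 3 * 1) := rfl

/-- **The landed direct row, read as a flat cubic**: `pinned_row_le_slots` at `(A₀, L_A) := (a·X, l·X/Λₙ₊₁)` + `e·X·(512·15367)` ≤ `klC3W·X`. -/
theorem pinned_row_W_le_klC3W {d A G a l e X : ℝ} (hdA : 0 < d - 4 * A) (hA : 0 ≤ A) (hA20 : 4 * A ≤ 1 / 20) (hG : 0 ≤ G) (ha : 0 ≤ a) (hl : 0 ≤ l)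
    (hX : 0 ≤ X) (hβ : klBetaMin ≤ β) {n : ℕ} (hn : n ≤ nScales β) {r : ℝ} (hr : 0 < r) (hrΛ : r ≤ klScale klE0 (n + 1)) (hβL : β ^ 2 ≤ (L : ℝ)) :
    2 * ((klScale klE0 n - klScale klE0 (n + 1)) * klmsRowBound d A G (a * X) (l * X / klScale klE0 (n + 1)) β n (n + 2) (G * r) L) +
        e * X * (512 * 15367) ≤ klC3W d A G a l e * X := by
  have hA0 : 0 ≤ a * X := mul_nonneg ha hX
  have hLa : 0 ≤ l * X / klScale klE0 (n + 1) := div_nonneg (mul_nonneg hl hX) (klth_klScale_pos _).le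
  have h1 := pinned_row_le_slots (L := L) (β := β) (G := G) hdA hA hA0 hLa hβ hn hr hrΛ
  have h2 := pinned_W_row_le_klC3W (L := L) (e := e) hdA hA hA20 hG ha hl hX hβ hn hrΛ hβL
  rw [klPinCZ_eq, klPinCT_eq, klPinCR_eq, klPinCL_eq] at h2
  linarith

/-- **The landed crossed row, read as a flat cubic**: `pinned_row_le_slots_shift` (`|s| = 2π/β`) at `(A₀, L_A) := (a·X, l·X/Λₙ₊₁)` + `e·X·(512·15367)` ≤ `klC3W·X`. -/
theorem pinned_row_shift_W_le_klC3W {d A G a l e X : ℝ} (hdA : 0 < d - 4 * A) (hA : 0 ≤ A) (hA20 : 4 * A ≤ 1 / 20) (hG : 0 ≤ G) (ha : 0 ≤ a) (hl : 0 ≤ l)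
    (hX : 0 ≤ X) (hβ : klBetaMin ≤ β) {n : ℕ} (hn : n ≤ nScales β) {r : ℝ} (hr : 0 < r) (hrΛ : r ≤ klScale klE0 (n + 1)) (hβL : β ^ 2 ≤ (L : ℝ))
    {s : ℝ} (hs : |s| = 2 * π / β) :
    2 * ((klScale klE0 n - klScale klE0 (n + 1)) * klmsRowBound d A G (a * X) (l * X / klScale klE0 (n + 1)) β n (n + 2) (|s| + G * r) L) +
        e * X * (512 * 15367) ≤ klC3W d A G a l e * X := by
  have hA0 : 0 ≤ a * X := mul_nonneg ha hX
  have hLa : 0 ≤ l * X / klScale klE0 (n + 1) := div_nonneg (mul_nonneg hl hX) (klth_klScale_pos _).le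
  have h1 := pinned_row_le_slots_shift (L := L) (β := β) (G := G) hdA hA hG hA0 hLa hβ hn hr hrΛ hs
  have h2 := pinned_W_row_shift_le_klC3W (L := L) (e := e) hdA hA hA20 hG ha hl hX hβ hn hrΛ hβL
  rw [klPinCZ_eq, klPinCT_eq, klPinCR_eq, klPinCL_eq] at h2
  linarith

/-! ## §3 The bar-level constant -/

/-- **`klC3 d A G a l e := 2·klC3W d A G a l e / 15367`** — the coefficient of `(Klam|U|)³` in `transferBarRelIdx3`'s pinned slot `klIdxPrefactor r (n+1)·klC3·K₃·klIdxOverlap`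
(`klIdxOverlap (n+1)(n+1) = 15367`): ONE direct + ONE crossed `W`-row per pinned entry (k3c1's (B4) twin confirms the multiplicity; if it is `m` rows, read `m·klC3W/15367`). -/
def klC3 (d A G a l e : ℝ) : ℝ := 2 * klC3W d A G a l e / 15367

/-- `klC3` unfolded. -/
theorem klC3_eq (d A G a l e : ℝ) : klC3 d A G a l e = 2 * klC3W d A G a l e / 15367 := rfl

/-- `0 ≤ klC3`. -/
theorem klC3_nonneg {d A G a l e : ℝ} (hdA : 0 < d - 4 * A) (hG : 0 ≤ G) (ha : 0 ≤ a) (hl : 0 ≤ l) (he : 0 ≤ e) : 0 ≤ klC3 d A G a l e := by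
  unfold klC3; have := klC3W_nonneg hdA hG ha hl he; positivity

/-- **The pinned slot hosts both `W`-rows**: for `1 ≤ p` (the prefactor `klIdxPrefactor r (n+1) ≥ r ≥ 1`), direct + crossed `W`-rows `≤ 2·klC3W·X = p·klC3·X·15367/p ≤ p·klC3·X·15367`. -/
theorem klC3_of_rows {d A G a l e X p Rd Rx : ℝ} (hdA : 0 < d - 4 * A) (hG : 0 ≤ G) (ha : 0 ≤ a) (hl : 0 ≤ l) (he : 0 ≤ e) (hX : 0 ≤ X) (hp : 1 ≤ p)
    (hd : Rd ≤ klC3W d A G a l e * X) (hx : Rx ≤ klC3W d A G a l e * X) :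
    Rd + Rx ≤ p * klC3 d A G a l e * X * 15367 := by
  rw [klC3_eq]
  have h0 : 0 ≤ klC3W d A G a l e * X := mul_nonneg (klC3W_nonneg hdA hG ha hl he) hX
  have e1 : p * (2 * klC3W d A G a l e / 15367) * X * 15367 = p * (2 * (klC3W d A G a l e * X)) := by ring
  rw [e1]
  nlinarith

end Summit.HubbardSuperconductivity.HubbardSuperconductivity.Theorems.EngineV8

end
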